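import Mathlib
import HarnessLib
import HarnessLib.Audit
import Summits.KontsevichZagierPeriods.Statement
import Literature.NumberTheory.Transcendental.KZProduct

/-!
Route: GaussBonnetChain

CLOSED (retired) 2026-08-15T13:48:28Z by operator:999:1257524 — reason: not-a-thesis: assembly does not conclude the sub-problem Statement — note: D-0027 §2.1 audit (human 2026-08-15: routes that do not decide the summit are removed): the assembly concludes `EqualRankCovolumes`, not the sub-problem statement; a NEW conforming route may be opened from the same idea (generated `closes : … → _root_.KontsevichZagierPeriods`).. The file is kept as the record of this route; refuted decls are indexed as negative knowledge (`ledger negatives`).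

# Route GaussBonnetChain — equal-rank covolumes are accessible π-powers — Chern transgression +
Poincaré–Hopf run as a finite chain of KZ moves (Sp₄(ℤ): π³/270; [5,3,3,3]: π²/10800)

SECTOR ROUTE (card gauss-bonnet-transgression-is-a-chain; X is an instance family of Conjecture 1,
`KontsevichZagierPeriods → X` holds
modulo the three classical VALUE theorems — item InstanceOfSummit — and `X →
KontsevichZagierPeriods` is NOT claimed). It suffices to show
X = EqualRankCovolumes = SLTwoZCovolume ∧ CoxeterPentachoron ∧ SpFourZCovolume: the covolume
representation of an EQUAL-RANK arithmetic /
reflection quotient Γ\G/K with its Siegel-type ℚ-semialgebraic fundamental domain is KZ-equivalent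
(finitely many instances of rules 1, 2, 3 of
KZ §1.2, tree calculus `Literature.NumberTheory.Transcendental.KZ.Equivalent`) to its rational
multiple of [disc]^{d/2}, in the three typed
instances d = 2: [F₁ = {|x| ≤ ½, x²+y² ≥ 1, y > 0}, y⁻²] ∼ [disc, 1/3] (π/3, SL₂(ℤ), calibration
with a cusp); d = 4: the compact Coxeter simplex
[5,3,3,3] in the Poincaré ball, [Δ, 16(1−|u|²)⁻⁴] ∼ [disc², 1/10800] (π²/10800 = (4π²/3)·χ^orb,
χ^orb = 1/14400); d = 6: Siegel's domain
F₂ of Sp₄(ℤ) (Klingen1990 Def. 3.1: |det(CZ+D)| ≥ 1 for all symmetric full-rank integer pairs, Y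
Minkowski-reduced 0 ≤ 2y₁₂ ≤ y₁₁ ≤ y₂₂,
|x_ij| ≤ ½), [F₂, det Y⁻³] ∼ [disc³, 1/270] (π³/270, Siegel1943 via Klingen1990 §I.3, printed p. 30
= PDF p. 56). The MECHANISM the route bets on (layer 2, after a crux
closes): Pf(Ω) = c′·dvol pointwise with c′ ∈ ℚ (both G-invariant); Chern's transgression Pf = dΠ
pulled back by a pairing-compatible
ℚ-semialgebraic C¹ vector field V; Stokes on F minus small balls is a combination of moves
(cylindrical decomposition: DivergenceLemma); paired faces
cancel by rule 2 along the pairing isometries (for reflections the restriction of V̂*Π to a mirror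
vanishes POINTWISE: the reflection reverses
orientation, Π ↦ −Π, and fixes V̂ on the mirror); at each zero two EXACT homotopy-Stokes steps
(linearise V, flatten the metric after recentring
so the local stabiliser acts linearly) and ONE change of variables along x ↦ Ax/|Ax| turn the flux
into ± a stabiliser-chamber of the fibre
sphere, i.e. (1/|Stab|)·[S^{d−1}] by tiling + IntegerDivision; sphere volumes are rational multiples
of [disc]^{d/2} (BallVolumes); cusps of
Sp₄(ℤ) need the two-parameter truncation {y₁₁ ≤ T, det Y ≤ T′y₁₁} with the explicit cusp field
φ(y₁₁)∂/∂y₂₂ + (1−φ(y₁₁))·(0, Y) and a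
compactified Newton–Leibniz at u = 0 (the single analytic check). The π's enter only as fibre-sphere
volumes at zeros of V; odd ζ-values never
appear (rank G ≠ rank K ⇒ Pf ≡ 0: the mechanism is silent on SL₃(ℤ) and Bianchi groups by design).
Lean: `SLTwoZCovolume ∧ CoxeterPentachoron ∧ SpFourZCovolume` (written out in full as the decl
EqualRankCovolumes; all constants `lean search --decl`-checked:
Literature.NumberTheory.Transcendental.KZ.IntegralRep / .Equivalent / .piDisc / .relations / .of /
.FormalRep, Literature.NumberTheory.Transcendental.IsSemialgebraicFunOn, KontsevichZagierPeriods;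
Sketch.lean rc 0)

## Assembly
Pure logic: the target is the conjunction of the two cruxes and the calibration support item
(∧-introduction; `example : Assembly := fun h6 h4 h2 =>
⟨h2, h4, h6⟩` and `example : EqualRankCovolumes ↔ SLTwoZCovolume ∧ CoxeterPentachoron ∧
SpFourZCovolume := Iff.rfl` in Sketch.lean, rc 0).
The mathematics sits in the cruxes; their common layer-2 children (compatible vector field,
truncated transgression, cusp term) are foreseen below.

Rationale: WHY THIS LINE. Kontsevich–Zagier list volumes of arithmetic quotients among the basic examples of
periods (KontsevichZagier2001 §1.1) and nobody has written a
rules-derivation of a single covolume identity beyond dimension 2; the card's point is that for rank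
G = rank K the identity vol = (2π)^{d/2}χ^orb/c′
has a CONSTRUCTIVE proof — Chern1944 (intrinsic Gauss–Bonnet by transgression on the sphere bundle)
+ Poincaré–Hopf, in Satake1957's orbifold
form and Harder1971's extension to arithmetic quotients — every step of which is a cut, an algebraic
substitution or a Newton–Leibniz move once the
metric is rational in algebraic coordinates (upper half-spaces, Siegel space, Poincaré/Klein balls)
and the vector field is semialgebraic. Imported:
Chern–Weil theory / differential topology (transgression, index of vector fields), reduction theory
(Siegel1943, Klingen1990: the domain F₂ and its
volume π³/270), hyperbolic reflection groups (JohnsonEtAl1999: vol[5,3,3,3] = π²/10800; χ^orb =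
Σ_{T: W_T finite}(−1)^{|T|}/|W_T| = 1/14400,
recomputed here and cross-checked on [5,3,3,4] ↦ 17π²/21600); real algebraic geometry
(BochnakCosteRoy1998 cylindrical decomposition) for Stokes
in the rules. What the line adds to the existing routes: LowDimension stratifies by dimension and
stops at d ≤ 1; ScissorsTransport wants one
volume-preserving map; here a named geometric mechanism produces new accessible identities in d = 4
and 6 whose only known value-proofs are
automorphic/analytic (Siegel's induction, Harder's regularisation), and it predicts its own boundary
(equal rank). Negatives index: empty.

RANKED CRUXES. #0 EqualRankCovolumes (target) — X = the three instance identities d = 2, 4, 6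
(SLTwoZCovolume ∧ CoxeterPentachoron ∧ SpFourZCovolume), written out without forward references.
(why it might fail: each conjunct is a Conjecture-1 instance (value theorems: π/3, JohnsonEtAl1999
π²/10800, Klingen1990 π³/270); as STATED it fails only by a transcription slip in a domain or a
rational constant — cheapest falsifier = numerics.) [KontsevichZagier2001, Klingen1990,
JohnsonEtAl1999, Harder1971]
#2 SpFourZCovolume (crux) — Siegel's covolume of Sp₄(ℤ) in the rules: for every integral
representation r with domain Siegel's F₂ ⊂ ℝ⁶ (coordinates x₁₁,x₁₂,x₂₂,y₁₁,y₁₂,y₂₂; Y > 0; |x_ij| ≤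
½; 0 ≤ 2y₁₂ ≤ y₁₁ ≤ y₂₂; |det(CZ+D)| ≥ 1 for all integer C, D with C Dᵀ symmetric and (C D) of rank
2) and integrand det Y⁻³, and every r′ = [disc³ ⊂ ℝ⁶, 1/270]: KZ.Equivalent r r′ (card T2, the d = 6
control of card siegel-tamagawa-zeta3-reduced-bases turned into a theorem-candidate). [deps:
DivergenceLemma, BallVolumes, IntegerDivision] [difficulty: XL] (why it might fail: The cusp: F₂
needs the 2-parameter truncation {y₁₁≤T, det Y≤T′y₁₁}; the transgression boundary terms on the two
cut faces + corner must be compactified Newton–Leibniz moves continuous at u=0 — Harder's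
regularisation says the DEFECT vanishes, not that each term is a move.) [Siegel1943, Klingen1990,
Harder1971, Chern1944, Satake1957]
#3 CoxeterPentachoron (crux) — the compact hyperbolic Coxeter simplex [5,3,3,3] (Gram matrix
−cos(π/m_ij), linear diagram 5-3-3-3) realised by outward normals e₀..e₄ ∈ ℝ^{4,1}, read in the
Poincaré ball B⁴ (faces −e⁰ᵢ(1+|u|²) + 2⟨eᵢ,u⟩ ≤ 0, nonempty interior), with the hyperbolic volume
density 16(1−|u|²)⁻⁴: [Δ, 16(1−|u|²)⁻⁴] ∼ [disc², 1/10800]. First informative dimension (refuter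
triage: d = 2 is calibration only); compact (no cusp), all pairings are reflections (facet terms
vanish pointwise), stabilisers finite Coxeter groups, an explicit compatible polynomial vector field
exists (affine image of a replicator field ẋ_k = x_k(f_k − Σx_jf_j) on the Klein simplex: tangent to
every face, one nondegenerate zero per face, eigenvalues on the normal cone equal ⇒
chamber-preserving linearisation), χ^orb = 1/14400. [deps: DivergenceLemma, BallVolumes,
IntegerDivision] [difficulty: XL] (why it might fail: The local flux at a zero on a codim-k face
must be EXACTLY ±[W_f-chamber of S³] after two homotopy-Stokes steps; if the linearisation does not
preserve the tangent cone (unequal normal eigenvalue signs) an uncontrolled spherical-simplex volume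
(Schläfli, Dehn-type obstruction in S³) appears.) [JohnsonEtAl1999, Chern1944, AllendoerferWeil1943,
Satake1957, BochnakCosteRoy1998]
#9 SLTwoZCovolume (support) — d = 2 calibration with a cusp: [F₁ = {|x| ≤ ½, x² + y² ≥ 1, y > 0},
y⁻²] ∼ [disc, 1/3] (π/3). Two chains expected: the 3-move angle-defect chain (y ↦ 1/y,
Newton–Leibniz, arcsin-type boundary rep, sixfold rotation of the disc) and the transgression chain
with a pairing-compatible field V interpolating (semialgebraic C¹ cutoff in y) between the
S-equivariant field (z²+1)(z⁴+z²+1)/z² near the arc |z| = 1 (zeros i, ρ, −ρ̄, as forced at the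
orbifold points) and ∂_y near the cusp (T-periodic; cusp term −dx/T, continuous at u = 1/T = 0),
made T-periodic near x = ±½ — the second calibrates the Sp₄ cusp step. [difficulty: M]
[KontsevichZagier2001, Klingen1990]
#9 IntegerDivision (support) — division by a positive integer is a DERIVED rule: n•c ∈ relations ⇒ c
∈ relations (the integrand-scaling endomorphism S_{1/n}[σ,f] = [σ,f/n] maps each of the four move
sets into itself, and [r] − n·S_{1/n}[r] ∈ relations by integrand additivity; so c ≡ S_{1/n}(n•c)
mod relations). Used to divide by stabiliser orders and to pass to finite-index subgroups; also
records that FormalRep ⧸ relations is torsion-free unconditionally. [difficulty: provable-now]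
[KontsevichZagier2001, HuberMullerStach2017]
#9 BallVolumes (support) — the π-bookkeeping of the fibre spheres: [B⁴, 1] ∼ [disc², 1/2] and [B⁶,
1] ∼ [disc³, 1/6] (vol B^{2k} = π^k/k!), by the algebraic polar substitution (x, y) ↦ (x² + y², y/x)
on the last pair of coordinates, Newton–Leibniz in the radial variable, and KZ's own chain ∫
dt/(1+t²) = [disc]. [difficulty: M] [KontsevichZagier2001]
#9 DivergenceLemma (support) — Stokes with compact support is derivable: for a bounded open
ℚ-semialgebraic U ⊂ ℝ^d and ℚ-semialgebraic η₁..η_d, C¹ on U with tsupport ηᵢ ⊆ U, the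
representation [U, Σᵢ ∂ᵢηᵢ] lies in KZ.relations (C¹ cylindrical decomposition along each coordinate
after a permutation of coordinates, one Newton–Leibniz move per band with primitive ηᵢ, inner graph
values cancel by integrand additivity, outer ones vanish). The boundary-term version used by the
cruxes is its layer-2 sibling (same proof, graph-parametrised boundary reps). [difficulty: L]
[BochnakCosteRoy1998, KontsevichZagier2001, HuberMullerStach2017]
#9 InstanceOfSummit (support) — KontsevichZagierPeriods → (the three classical value equalities
r.value = r′.value for the pairs of SLTwoZCovolume, CoxeterPentachoron, SpFourZCovolume) →
EqualRankCovolumes: all six representations have KZ-rational integrands (1/y², 16/(1−Σu²)⁴, 1/det³,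
constants), so the summit applies verbatim. Documents that X is an instance family of the summit
modulo Siegel1943/Klingen1990 (π³/270), JohnsonEtAl1999 + Gauss–Bonnet (π²/10800) and ∫_{F₁} y⁻² =
π/3. [difficulty: provable-now] [KontsevichZagier2001, Klingen1990, JohnsonEtAl1999]

TWO-LAYER PLAN. Foreseen glued splits (k ≤ 3, depth 1), filed only when a crux closes or a grounder
types the children: SpFourZCovolume ⇐ SpFourInvariantField
(∃ pairing-compatible ℚ-semialgebraic C¹ field on the truncated domain F₂ ∩ {y₁₁ ≤ T} ∩ {det Y ≤
T′y₁₁}, equal to φ(y₁₁)∂_{y₂₂} + (1−φ(y₁₁))(0,Y)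
near the cuts, finitely many nondegenerate zeros; filed now as an informal crux) →
SpFourTruncatedTransgression ([F₂(T,T′), −(3/2)det Y⁻³] ∼
zero terms + cut-face terms, for rational T, T′) → SpFourCuspTerm (cut-face terms + [tail, Pf] ∼ 0
by compactified Newton–Leibniz) →
SpFourZCovolume. CoxeterPentachoron ⇐ PentachoronTransgression (Stokes on Δ minus 31 ball-sectors
with the replicator field) → ChamberFlux (local
flux = (−1)^{dim f}[W_f-chamber]) → CoxeterPentachoron (glue: 31 chamber terms + BallVolumes +
IntegerDivision). A general EqualRankTransgression
schema (any equal-rank Γ with Siegel-type domain) is filed informal and waits for the definition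
request (Euler form / Chern transgression form of
a coordinate metric).

KILL CRITERIA. A refutation of SpFourZCovolume or CoxeterPentachoron AS TYPED by a value mismatch
means a transcription slip (domain or constant): repair by
restate, not a kill. A kill of the LINE: (i) a proof that some step of the transgression chain is
not a combination of moves for Sp₄(ℤ) — e.g. the
cut-face terms of the truncation provably admit no ℚ-semialgebraic primitive continuous at u = 0 (an
Ayoub/Yoshinaga-type non-elementarity of the
cusp term: close `refuted:SpFourZCovolume` for the mechanism, hand the witness to card
log-corner-deregularisation-functor); (ii) for [5,3,3,3],
a zero of every face-compatible semialgebraic field forced to have a non-chamber-preserving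
linearisation (then the vertex terms are genuine
spherical Schläfli volumes and the route pivots to the spherical-scissors cards). LowDimension
reaching d = 6 or ScissorsTransport proved would
moot the route (they imply X).

NOT DECOMPOSED YET. The compatible vector fields (explicit for the pentachoron, soft-existence +
explicit cusp field for F₂), the boundary-term form of the
divergence lemma, Chern's Π for the Siegel and Poincaré metrics as explicit semialgebraic forms (a
symbolic identity div(V̂*Π) = c′·density,
checkable by kit), the recentring isometries at orbifold zeros, the (2,3,7)/[7,3] triangle (π/42)
and Hilbert-modular / Picard d = 4 cases, and
the general schema — all layer 2. No definition is needed for the typed items; the schema needs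
`eulerForm`/`chernTransgression` (definition request).

CHEAPEST FALSIFIER. Numerics on the three constants (refuters first): Monte-Carlo ∫_{F₂} det Y⁻³
against π³/270 = 0.11483… using Gottschling's finite list
(or height-reduction) — a factor-2 slip (±1, y₁₂ ≥ 0) would show at once; ∫_Δ 16(1−|u|²)⁻⁴ du
against π²/10800 = 9.139·10⁻⁴ for one algebraic
realisation of the Gram matrix; ∫_{F₁} y⁻² = π/3 by hand. Done here: Klingen1990 §I.3 PDF p. 56 (vol
F_n = 2π^{−n(n+1)/2}∏(k−1)!ζ(2k) with
dv = dx dy/det y^{n+1}) ⇒ π³/270 ✓; χ^orb[5,3,3,3] = 1/14400 recomputed exactly and the method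
cross-checked on [5,3,3,4] (17π²/21600) and
[5,3,3,5] (13π²/5400) ✓; Sketch.lean elaborates (rc 0). Second-cheapest: the SL₂(ℤ) transgression
chain by hand (three terms must sum to π/3).

NUMBERS. vol(Sp₄(ℤ)\𝔥₂) = π³/270 (dv = dXdY/det Y³; Klingen1990 §3, Siegel1943); χ(Sp₄(ℤ)) =
ζ(−1)ζ(−3) = −1/1440 (Harder1971), χ^orb of the
quotient = −1/720, hence c′ = Pf/dvol = −3/2·(convention); vol[5,3,3,3] = π²/10800, χ^orb = 1/14400,
vol = (4π²/3)χ^orb in H⁴ (JohnsonEtAl1999);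
vol B⁴ = π²/2, vol B⁶ = π³/6, vol S³ = 2π², vol S⁵ = π³; area(F₁) = π/3; (2,3,7): π/42. Items at
open: 9 (1 target, 2 cruxes, 5 support, 1 assembly).

DEFINITION REQUESTS. To be filed after open: `chernTransgression` (Literature/Geometry: for a metric
g given in coordinates on an open set of ℝ^d, d even, and a
nonvanishing C¹ vector field V, the Pfaffian density Pf_g and the (d−1)-form components Π_g(V) with
Σ∂ᵢΠᵢ = Pf_g — Chern1944 Thm, as a
definition + named fact), needed to type the schema EqualRankTransgression and the layer-2 children;
cite facts Chern1944 (π*Pf = dΠ),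
Harder1971 (Gauss–Bonnet for arithmetic groups), Siegel1943/Klingen1990 (vol F₂), JohnsonEtAl1999
(vol [5,3,3,3]).

Novelty: Searches (2026-08-15): `lit frontier KontsevichZagierPeriods --since 2020` (30 rows:
MZV/coaction/odd-zeta/log-corners, none on covolumes as KZ
identities); `lit bridges KontsevichZagierPeriods --cross any` (30 rows, none relevant); `lit galaxy
search "period conjecture Gauss-Bonnet"
--star all` (0 hits); `lit vsearch` for Siegel's volume formula (→
book:klingen1990-introductory-lectures-siegel-modular-forms, read PDF pp. 37, 39, 51–56)
and for Coxeter simplex volumes (zbMATH → doi:10.1007/bf01238563, paywalled, acq-02363; values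
recomputed); the card's own search of the 57
sibling cards (no Euler form / Poincaré–Hopf elsewhere; weil-petersson transgresses a different
form) and its triage audit (new-combination).
Nearest prior art found: Chern1944 (doi:10.2307/1969302) and AllendoerferWeil1943 — the
transgression/polyhedral Gauss–Bonnet as analysis;
Harder1971 (doi:10.24033/asens.1217) — Gauss–Bonnet for arithmetic quotients, values read off
Siegel-type formulas; Satake1957 — orbifold version;
KontsevichZagier2001 §1.1 — volumes as periods, no derivations; CressonViusos2022 / ViuSos2021 —
semi-canonical reductions, polytopes only.
Delta: running Chern's transgression + Poincaré–Hopf as an explicit finite chain of KZ moves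
(π^{d/2} only from fibre spheres at zeros, exact
homotopy steps instead of limits, reflections killing facet terms pointwise, division as a derived
rule) to produce NEW typed accessible identities
in d = 4 ([5,3,3,3], π²/10800) and d = 6 (Sp₄(ℤ), π³/270) wit  [refs: 10.1007/bf01238563, 10.2307/1969302, 10.24033/asens.1217, book:klingen1990-introductory-lectures-siegel-modular-forms, doi:10.1007/bf01238563, doi:10.2307/1969302, doi:10.24033/asens.1217, Chern1944, AllendoerferWeil1943, Harder1971, Satake1957, KontsevichZagier2001, CressonViusos2022, ViuSos2021]

Barriers (technique_class: chern-gauss-bonnet transgression poincare-hopf equal-rank): - technique_class: chern-gauss-bonnet transgression poincare-hopf equal-rank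
- Literature.Barriers.KontsevichZagierPeriods.kzConjecture_implies_oddZetaAlgIndep: not engaged — a
sector route; the mechanism provably outputs only ℚ·π^{d/2} (Euler numbers) and is silent where
ζ(odd) lives (rank G ≠ rank K ⇒ Pf ≡ 0); no strength claim toward the summit is made (X → summit not
claimed).
- Literature.Barriers.KontsevichZagierPeriods.kzConjecture_implies_twoPiI_log_algIndep: not engaged
(no logarithms of algebraic numbers are produced or compared; same sector remark).
- Literature.Barriers.KontsevichZagierPeriods.kzConjecture_implies_ellipticPeriods_algIndep: not
engaged (no elliptic periods).
- Literature.Barriers.KontsevichZagierPeriods.noSemialgebraicPrimitive_inv_sub_two: evaded — every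
primitive used is explicit and semialgebraic by construction (components of V̂*Π: polynomial in
rational connection/curvature forms and the algebraic unit field; radial primitives t, 1/t; the
scaling map of IntegerDivision); no fibre variable of an arbitrary rational integrand is eliminated,
and the one place a non-elementary primitive could be forced (the Sp₄ cusp term at u = 0) is named
as the rank-2 risk.
- Literature.Barriers.KontsevichZagierPeriods.cressonViuSos_prop_3_2: irrelevant — dissection (rule
1) is used throughout; no single global map is sought.
- Literature.Barriers.KontsevichZagierPeriods.not_complete_of_undecidable: consistent — the route
proves finitely many explicit identities

History (route lifecycle, newest last):
- 2026-08-15T13:48:28Z · CLOSED retired — not-a-thesis: assembly does not conclude the sub-problem Statement (operator:999:1257524)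

sub-problem: KontsevichZagierPeriods · status: closed(retired) · opened planner-plancard-KontsevichZagierPeriods-Kont-215fcf2c-0 2026-08-15T11:44:11Z · rev 0 · ledger route-KontsevichZagierPeriods-GaussBonnetChain
GENERATED by the gate from the ledger (D-0016/17). Provers cite these decls: `theorem foo : Summit.KontsevichZagierPeriods.KontsevichZagierPeriods.Theses.GaussBonnetChain.<Decl> := …` in Summits/KontsevichZagierPeriods/KontsevichZagierPeriods/Theorems/<Name>.lean.
-/

namespace Summit.KontsevichZagierPeriods.KontsevichZagierPeriods.Theses.GaussBonnetChain

open scoped BigOperators Topology Manifold Classical MeasureTheory ProbabilityTheory Matrix InnerProductSpace ComplexConjugate ContinuousMap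
open Filter Set Function TopologicalSpace MeasureTheory

attribute [summit_statement] _root_.KontsevichZagierPeriods

open Literature Periods

/-- item stmt-KontsevichZagierPeriods-6055 · target · rank 0 · closed · moot by None · by planner
why it might fail: each conjunct is a Conjecture-1 instance (value theorems: π/3, JohnsonEtAl1999 π²/10800, Klingen1990 π³/270); as STATED it fails only by a transcription slip in a domain or a rational constant — cheapest falsifier = numerics.
sources: KontsevichZagier2001, Klingen1990, JohnsonEtAl1999, Harder1971
[target] X = the three instance identities d = 2, 4, 6 (SLTwoZCovolume ∧ CoxeterPentachoron ∧
SpFourZCovolume), written out without forward references. -/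
@[route_item "route-KontsevichZagierPeriods-GaussBonnetChain"]
def EqualRankCovolumes : Prop :=
  (∀ (r r' : Literature.NumberTheory.Transcendental.KZ.IntegralRep 2), r.domain = {x | |x 0| ≤ 1 / 2 ∧ 1 ≤ x 0 ^ 2 + x 1 ^ 2 ∧ 0 < x 1} → Set.EqOn r.integrand (fun x => 1 / x 1 ^ 2) r.domain → r'.domain = Literature.NumberTheory.Transcendental.KZ.piDisc → Set.EqOn r'.integrand (fun _ => 1 / 3) r'.domain → Literature.NumberTheory.Transcendental.KZ.Equivalent r r') ∧ (∀ (e : Fin 5 → Fin 5 → ℝ), (∀ i j : Fin 5, - (e i 0 * e j 0) + ∑ k : Fin 4, e i k.succ * e j k.succ = - Real.cos (Real.pi / (if i = j then (1 : ℝ) else if i.val + 1 = j.val ∨ j.val + 1 = i.val then (if i.val + j.val = 1 then 5 else 3) else 2))) → ∀ (r r' : Literature.NumberTheory.Transcendental.KZ.IntegralRep 4), r.domain = {u | ∑ k, u k ^ 2 < 1 ∧ ∀ i : Fin 5, - (e i 0 * (1 + ∑ k, u k ^ 2)) + 2 * ∑ k : Fin 4, e i k.succ * u k ≤ 0} → (interior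 r.domain).Nonempty → Set.EqOn r.integrand (fun u => 16 / (1 - ∑ k, u k ^ 2) ^ 4) r.domain → r'.domain = {u | u 0 ^ 2 + u 1 ^ 2 ≤ 1 ∧ u 2 ^ 2 + u 3 ^ 2 ≤ 1} → Set.EqOn r'.integrand (fun _ => 1 / 10800) r'.domain → Literature.NumberTheory.Transcendental.KZ.Equivalent r r') ∧ (∀ (r r' : Literature.NumberTheory.Transcendental.KZ.IntegralRep 6), r.domain = {x | 0 < x 3 ∧ x 4 ^ 2 < x 3 * x 5 ∧ |x 0| ≤ 1 / 2 ∧ |x 1| ≤ 1 / 2 ∧ |x 2| ≤ 1 / 2 ∧ 0 ≤ x 4 ∧ 2 * x 4 ≤ x 3 ∧ x 3 ≤ x 5 ∧ ∀ (c₁ c₂ c₃ c₄ d₁ d₂ d₃ d₄ : ℤ), c₁ * d₃ + c₂ * d₄ = c₃ * d₁ + c₄ * d₂ → (c₁ * c₄ - c₂ * c₃ ≠ 0 ∨ c₁ * d₃ - d₁ * c₃ ≠ 0 ∨ c₁ * d₄ - d₂ * c₃ ≠ 0 ∨ c₂ * d₃ - d₁ * c₄ ≠ 0 ∨ c₂ *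 d₄ - d₂ * c₄ ≠ 0 ∨ d₁ * d₄ - d₂ * d₃ ≠ 0) → 1 ≤ ‖((c₁ : ℂ) * ((x 0 : ℂ) + (x 3 : ℂ) * Complex.I) + (c₂ : ℂ) * ((x 1 : ℂ) + (x 4 : ℂ) * Complex.I) + (d₁ : ℂ)) * ((c₃ : ℂ) * ((x 1 : ℂ) + (x 4 : ℂ) * Complex.I) + (c₄ : ℂ) * ((x 2 : ℂ) + (x 5 : ℂ) * Complex.I) + (d₄ : ℂ)) - ((c₁ : ℂ) * ((x 1 : ℂ) + (x 4 : ℂ) * Complex.I) + (c₂ : ℂ) * ((x 2 : ℂ) + (x 5 : ℂ) * Complex.I) + (d₂ : ℂ)) * ((c₃ : ℂ) * ((x 0 : ℂ) + (x 3 : ℂ) * Complex.I) + (c₄ : ℂ) * ((x 1 : ℂ) + (x 4 : ℂ) * Complex.I) + (d₃ : ℂ))‖} → Set.EqOn r.integrand (fun x => 1 / (x 3 * x 5 - x 4 ^ 2) ^ 3) r.domain → r'.domain = {x | x 0 ^ 2 + x 1 ^ 2 ≤ 1 ∧ x 2 ^ 2 + x 3 ^ 2 ≤ 1 ∧ x 4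 ^ 2 + x 5 ^ 2 ≤ 1} → Set.EqOn r'.integrand (fun _ => 1 / 270) r'.domain → Literature.NumberTheory.Transcendental.KZ.Equivalent r r')

/-- item stmt-KontsevichZagierPeriods-6056 · crux · rank 2 · closed · moot by None · by planner
why it might fail: The cusp: F₂ needs the 2-parameter truncation {y₁₁≤T, det Y≤T′y₁₁}; the transgression boundary terms on the two cut faces + corner must be compactified Newton–Leibniz moves continuous at u=0 — Harder's regularisation says the DEFECT vanishes, not that each term is a move.
sources: Siegel1943, Klingen1990, Harder1971, Chern1944, Satake1957
[crux] Siegel's covolume of Sp₄(ℤ) in the rules: for every integral representation r with domain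
Siegel's F₂ ⊂ ℝ⁶ (coordinates x₁₁,x₁₂,x₂₂,y₁₁,y₁₂,y₂₂; Y > 0; |x_ij| ≤ ½; 0 ≤ 2y₁₂ ≤ y₁₁ ≤ y₂₂;
|det(CZ+D)| ≥ 1 for all integer C, D with C Dᵀ symmetric and (C D) of rank 2) and integrand det Y⁻³,
and every r′ = [disc³ ⊂ ℝ⁶, 1/270]: KZ.Equivalent r r′ (card T2, the d = 6 control of card
siegel-tamagawa-zeta3-reduced-bases turned into a theorem-candidate). [deps: DivergenceLemma,
BallVolumes, IntegerDivision] [difficulty: XL] -/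
@[route_item "route-KontsevichZagierPeriods-GaussBonnetChain"]
def SpFourZCovolume : Prop :=
  ∀ (r r' : Literature.NumberTheory.Transcendental.KZ.IntegralRep 6), r.domain = {x | 0 < x 3 ∧ x 4 ^ 2 < x 3 * x 5 ∧ |x 0| ≤ 1 / 2 ∧ |x 1| ≤ 1 / 2 ∧ |x 2| ≤ 1 / 2 ∧ 0 ≤ x 4 ∧ 2 * x 4 ≤ x 3 ∧ x 3 ≤ x 5 ∧ ∀ (c₁ c₂ c₃ c₄ d₁ d₂ d₃ d₄ : ℤ), c₁ * d₃ + c₂ * d₄ = c₃ * d₁ + c₄ * d₂ → (c₁ * c₄ - c₂ * c₃ ≠ 0 ∨ c₁ * d₃ - d₁ * c₃ ≠ 0 ∨ c₁ * d₄ - d₂ * c₃ ≠ 0 ∨ c₂ * d₃ - d₁ * c₄ ≠ 0 ∨ c₂ * d₄ - d₂ * c₄ ≠ 0 ∨ d₁ * d₄ - d₂ * d₃ ≠ 0) → 1 ≤ ‖((c₁ : ℂ) * ((x 0 : ℂ) + (x 3 : ℂ) * Complex.I) + (c₂ : ℂ) * ((x 1 : ℂ) + (x 4 : ℂ) * Complex.I)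 + (d₁ : ℂ)) * ((c₃ : ℂ) * ((x 1 : ℂ) + (x 4 : ℂ) * Complex.I) + (c₄ : ℂ) * ((x 2 : ℂ) + (x 5 : ℂ) * Complex.I) + (d₄ : ℂ)) - ((c₁ : ℂ) * ((x 1 : ℂ) + (x 4 : ℂ) * Complex.I) + (c₂ : ℂ) * ((x 2 : ℂ) + (x 5 : ℂ) * Complex.I) + (d₂ : ℂ)) * ((c₃ : ℂ) * ((x 0 : ℂ) + (x 3 : ℂ) * Complex.I) + (c₄ : ℂ) * ((x 1 : ℂ) + (x 4 : ℂ) * Complex.I) + (d₃ : ℂ))‖} → Set.EqOn r.integrand (fun x => 1 / (x 3 * x 5 - x 4 ^ 2) ^ 3) r.domain → r'.domain = {x | x 0 ^ 2 + x 1 ^ 2 ≤ 1 ∧ x 2 ^ 2 + x 3 ^ 2 ≤ 1 ∧ x 4 ^ 2 + x 5 ^ 2 ≤ 1} → Set.EqOn r'.integrand (fun _ => 1 / 270) r'.domain → Literature.NumberTheory.Transcendental.KZ.Equivalent r r'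

/-- item stmt-KontsevichZagierPeriods-6057 · crux · rank 3 · closed · moot by None · by planner
why it might fail: The local flux at a zero on a codim-k face must be EXACTLY ±[W_f-chamber of S³] after two homotopy-Stokes steps; if the linearisation does not preserve the tangent cone (unequal normal eigenvalue signs) an uncontrolled spherical-simplex volume (Schläfli, Dehn-type obstruction in S³) appears.
sources: JohnsonEtAl1999, Chern1944, AllendoerferWeil1943, Satake1957, BochnakCosteRoy1998
[crux] the compact hyperbolic Coxeter simplex [5,3,3,3] (Gram matrix −cos(π/m_ij), linear diagram
5-3-3-3) realised by outward normals e₀..e₄ ∈ ℝ^{4,1}, read in the Poincaré ball B⁴ (faces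
−e⁰ᵢ(1+|u|²) + 2⟨eᵢ,u⟩ ≤ 0, nonempty interior), with the hyperbolic volume density 16(1−|u|²)⁻⁴: [Δ,
16(1−|u|²)⁻⁴] ∼ [disc², 1/10800]. First informative dimension (refuter triage: d = 2 is calibration
only); compact (no cusp), all pairings are reflections (facet terms vanish pointwise), stabilisers
finite Coxeter groups, an explicit compatible polynomial vector field exists (affine image of a
replicator field ẋ_k = x_k(f_k − Σx_jf_j) on the Klein simplex: tangent to every face, one
nondegenerate zero per face, eigenvalues on the normal cone equal ⇒ chamber-preserving
linearisation), χ^orb = 1/14400. [deps: DivergenceLemma, BallVolumes, IntegerDivision] [difficulty: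
XL] -/
@[route_item "route-KontsevichZagierPeriods-GaussBonnetChain"]
def CoxeterPentachoron : Prop :=
  ∀ (e : Fin 5 → Fin 5 → ℝ), (∀ i j : Fin 5, - (e i 0 * e j 0) + ∑ k : Fin 4, e i k.succ * e j k.succ = - Real.cos (Real.pi / (if i = j then (1 : ℝ) else if i.val + 1 = j.val ∨ j.val + 1 = i.val then (if i.val + j.val = 1 then 5 else 3) else 2))) → ∀ (r r' : Literature.NumberTheory.Transcendental.KZ.IntegralRep 4), r.domain = {u | ∑ k, u k ^ 2 < 1 ∧ ∀ i : Fin 5, - (e i 0 * (1 + ∑ k, u k ^ 2)) + 2 * ∑ k : Fin 4, e i k.succ * u k ≤ 0} → (interior r.domain).Nonempty → Set.EqOn r.integrand (fun u => 16 / (1 - ∑ k, u k ^ 2) ^ 4) r.domain → r'.domain = {u | u 0 ^ 2 + u 1 ^ 2 ≤ 1 ∧ u 2 ^ 2 + u 3 ^ 2 ≤ 1} → Set.EqOn r'.integrand (fun _ => 1 / 10800) r'.domain → Literature.NumberTheory.Transcendental.KZ.Equivalent r r'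

-- item stmt-KontsevichZagierPeriods-7188 · support · rank 4 · closed · moot by None · by planner — informal only, no Lean statement yet:
--   [crux] SpFourInvariantField (layer-2 input of SpFourZCovolume, filed informal; refuter-triage's
--   "real rank-2 crux" (a) of card gauss-bonnet-transgression-is-a-chain). On the two-parameter
--   truncated Siegel domain F₂(T,T′) := F₂ ∩ {y₁₁ ≤ T} ∩ {det Y ≤ T′·y₁₁} (T, T′ large rationals; F₂
--   exactly as in SpFourZCovolume, coordinates (x₁₁,x₁₂,x₂₂,y₁₁,y₁₂,y₂₂) : Fin 6 → ℝ) there is a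
--   ℚ-semialgebraic vector field V, C¹ on a neighbourhood, PAIRING-COMPATIBLE: V(γ·x) = d(γ·)_x V(x)
--   whenever x and γ·x both lie in F₂(T,T′), γ = (A B; C D) ∈ Sp₄(ℤ) acting by Z ↦ (AZ+B)(CZ+D)⁻¹; equal
--   near the two cut faces t

-- item stmt-KontsevichZagierPeriods-7208 · support · rank 5 · closed · moot by None · by planner — informal only, no Lean statement yet:
--   [crux] EqualRankTransgression — the schema behind the three typed instances (card E1–E4); informal
--   until the definition request `chernTransgression` (Euler/Pfaffian density and Chern's transgression
--   form of a coordinate metric) lands. For d even, a closed ℚ-semialgebraic domain F ⊂ ℝ^d with a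
--   Riemannian metric g RATIONAL in the coordinates, finitely many ℚ-semialgebraic face-pairing
--   isometries γ_i of g covering ∂F except the cut faces of a truncation, and a pairing-compatible
--   ℚ-semialgebraic C¹ vector field V with finitely many nondegenerate, tangent-cone-preserving zeros
--   z_j (stabiliser order

/-- item stmt-KontsevichZagierPeriods-6058 · support · rank 9 · closed · moot by None · by planner
sources: KontsevichZagier2001, Klingen1990
[support] d = 2 calibration with a cusp: [F₁ = {|x| ≤ ½, x² + y² ≥ 1, y > 0}, y⁻²] ∼ [disc, 1/3]
(π/3). Two chains expected: the 3-move angle-defect chain (y ↦ 1/y, Newton–Leibniz, arcsin-type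
boundary rep, sixfold rotation of the disc) and the transgression chain with a pairing-compatible
field V interpolating (semialgebraic C¹ cutoff in y) between the S-equivariant field
(z²+1)(z⁴+z²+1)/z² near the arc |z| = 1 (zeros i, ρ, −ρ̄, as forced at the orbifold points) and ∂_y
near the cusp (T-periodic; cusp term −dx/T, continuous at u = 1/T = 0), made T-periodic near x = ±½
— the second calibrates the Sp₄ cusp step. [difficulty: M] -/
@[route_item "route-KontsevichZagierPeriods-GaussBonnetChain"]
def SLTwoZCovolume : Prop :=
  ∀ (r r' : Literature.NumberTheory.Transcendental.KZ.IntegralRep 2), r.domain = {x | |x 0| ≤ 1 / 2 ∧ 1 ≤ x 0 ^ 2 + x 1 ^ 2 ∧ 0 < x 1} → Set.EqOn r.integrand (fun x => 1 / x 1 ^ 2) r.domain → r'.domain = Literature.NumberTheory.Transcendental.KZ.piDisc → Set.EqOn r'.integrand (fun _ => 1 / 3) r'.domain → Literature.NumberTheory.Transcendental.KZ.Equivalent r r'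

/-- item stmt-KontsevichZagierPeriods-6059 · support · rank 9 · closed · moot by None · by planner
sources: KontsevichZagier2001, HuberMullerStach2017
[support] division by a positive integer is a DERIVED rule: n•c ∈ relations ⇒ c ∈ relations (the
integrand-scaling endomorphism S_{1/n}[σ,f] = [σ,f/n] maps each of the four move sets into itself,
and [r] − n·S_{1/n}[r] ∈ relations by integrand additivity; so c ≡ S_{1/n}(n•c) mod relations). Used
to divide by stabiliser orders and to pass to finite-index subgroups; also records that FormalRep ⧸
relations is torsion-free unconditionally. [difficulty: provable-now] -/
@[route_item "route-KontsevichZagierPeriods-GaussBonnetChain"]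
def IntegerDivision : Prop :=
  ∀ (n : ℕ) (c : Literature.NumberTheory.Transcendental.KZ.FormalRep), 0 < n → n • c ∈ Literature.NumberTheory.Transcendental.KZ.relations → c ∈ Literature.NumberTheory.Transcendental.KZ.relations

/-- item stmt-KontsevichZagierPeriods-6060 · support · rank 9 · closed · moot by None · by planner
sources: KontsevichZagier2001
[support] the π-bookkeeping of the fibre spheres: [B⁴, 1] ∼ [disc², 1/2] and [B⁶, 1] ∼ [disc³, 1/6]
(vol B^{2k} = π^k/k!), by the algebraic polar substitution (x, y) ↦ (x² + y², y/x) on the last pair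
of coordinates, Newton–Leibniz in the radial variable, and KZ's own chain ∫ dt/(1+t²) = [disc].
[difficulty: M] -/
@[route_item "route-KontsevichZagierPeriods-GaussBonnetChain"]
def BallVolumes : Prop :=
  (∀ (r r' : Literature.NumberTheory.Transcendental.KZ.IntegralRep 4), r.domain = {u | ∑ k, u k ^ 2 ≤ 1} → Set.EqOn r.integrand (fun _ => 1) r.domain → r'.domain = {u | u 0 ^ 2 + u 1 ^ 2 ≤ 1 ∧ u 2 ^ 2 + u 3 ^ 2 ≤ 1} → Set.EqOn r'.integrand (fun _ => 1 / 2) r'.domain → Literature.NumberTheory.Transcendental.KZ.Equivalent r r') ∧ (∀ (r r' : Literature.NumberTheory.Transcendental.KZ.IntegralRep 6), r.domain = {x | ∑ k, x k ^ 2 ≤ 1} → Set.EqOn r.integrand (fun _ => 1) r.domain → r'.domain = {x | x 0 ^ 2 + x 1 ^ 2 ≤ 1 ∧ x 2 ^ 2 + x 3 ^ 2 ≤ 1 ∧ x 4 ^ 2 + x 5 ^ 2 ≤ 1} → Set.EqOn r'.integrand (fun _ => 1 / 6) r'.domain → Literature.NumberTheory.Transcendental.KZ.Equivalent r r')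

/-- item stmt-KontsevichZagierPeriods-6061 · support · rank 9 · closed · moot by None · by planner
sources: BochnakCosteRoy1998, KontsevichZagier2001, HuberMullerStach2017
[support] Stokes with compact support is derivable: for a bounded open ℚ-semialgebraic U ⊂ ℝ^d and
ℚ-semialgebraic η₁..η_d, C¹ on U with tsupport ηᵢ ⊆ U, the representation [U, Σᵢ ∂ᵢηᵢ] lies in
KZ.relations (C¹ cylindrical decomposition along each coordinate after a permutation of coordinates,
one Newton–Leibniz move per band with primitive ηᵢ, inner graph values cancel by integrand
additivity, outer ones vanish). The boundary-term version used by the cruxes is its layer-2 sibling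
(same proof, graph-parametrised boundary reps). [difficulty: L] -/
@[route_item "route-KontsevichZagierPeriods-GaussBonnetChain"]
def DivergenceLemma : Prop :=
  ∀ ⦃d : ℕ⦄ (r : Literature.NumberTheory.Transcendental.KZ.IntegralRep d) (η : Fin d → (Fin d → ℝ) → ℝ), IsOpen r.domain → Bornology.IsBounded r.domain → (∀ i, Literature.NumberTheory.Transcendental.IsSemialgebraicFunOn ℚ r.domain (η i)) → (∀ i, ContDiffOn ℝ 1 (η i) r.domain) → (∀ i, tsupport (η i) ⊆ r.domain) → (∀ x ∈ r.domain, r.integrand x = ∑ i, fderiv ℝ (η i) x (Pi.single i 1)) → Literature.NumberTheory.Transcendental.KZ.of r ∈ Literature.NumberTheory.Transcendental.KZ.relations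

/-- item stmt-KontsevichZagierPeriods-6062 · support · rank 9 · closed · moot by None · by planner
sources: KontsevichZagier2001, Klingen1990, JohnsonEtAl1999
[support] KontsevichZagierPeriods → (the three classical value equalities r.value = r′.value for the
pairs of SLTwoZCovolume, CoxeterPentachoron, SpFourZCovolume) → EqualRankCovolumes: all six
representations have KZ-rational integrands (1/y², 16/(1−Σu²)⁴, 1/det³, constants), so the summit
applies verbatim. Documents that X is an instance family of the summit modulo Siegel1943/Klingen1990
(π³/270), JohnsonEtAl1999 + Gauss–Bonnet (π²/10800) and ∫_{F₁} y⁻² = π/3. [difficulty: provable-now] -/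
@[route_item "route-KontsevichZagierPeriods-GaussBonnetChain"]
def InstanceOfSummit : Prop :=
  KontsevichZagierPeriods → (∀ (r r' : Literature.NumberTheory.Transcendental.KZ.IntegralRep 2), r.domain = {x | |x 0| ≤ 1 / 2 ∧ 1 ≤ x 0 ^ 2 + x 1 ^ 2 ∧ 0 < x 1} → Set.EqOn r.integrand (fun x => 1 / x 1 ^ 2) r.domain → r'.domain = Literature.NumberTheory.Transcendental.KZ.piDisc → Set.EqOn r'.integrand (fun _ => 1 / 3) r'.domain → r.value = r'.value) → (∀ (e : Fin 5 → Fin 5 → ℝ), (∀ i j : Fin 5, - (e i 0 * e j 0) + ∑ k : Fin 4, e i k.succ * e j k.succ = - Real.cos (Real.pi / (if i = j then (1 : ℝ) else if i.val + 1 = j.val ∨ j.val + 1 = i.val then (if i.val + j.val = 1 then 5 else 3) else 2))) → ∀ (r r' : Literature.NumberTheory.Transcendental.KZ.IntegralRep 4), r.domain = {u | ∑ k, u k ^ 2 < 1 ∧ ∀ i : Fin 5, - (e i 0 * (1 + ∑ k, u k ^ 2)) + 2 * ∑ k : Fin 4, e i k.succ * u k ≤ 0} → (interior r.domain).Nonempty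 → Set.EqOn r.integrand (fun u => 16 / (1 - ∑ k, u k ^ 2) ^ 4) r.domain → r'.domain = {u | u 0 ^ 2 + u 1 ^ 2 ≤ 1 ∧ u 2 ^ 2 + u 3 ^ 2 ≤ 1} → Set.EqOn r'.integrand (fun _ => 1 / 10800) r'.domain → r.value = r'.value) → (∀ (r r' : Literature.NumberTheory.Transcendental.KZ.IntegralRep 6), r.domain = {x | 0 < x 3 ∧ x 4 ^ 2 < x 3 * x 5 ∧ |x 0| ≤ 1 / 2 ∧ |x 1| ≤ 1 / 2 ∧ |x 2| ≤ 1 / 2 ∧ 0 ≤ x 4 ∧ 2 * x 4 ≤ x 3 ∧ x 3 ≤ x 5 ∧ ∀ (c₁ c₂ c₃ c₄ d₁ d₂ d₃ d₄ : ℤ), c₁ * d₃ + c₂ * d₄ = c₃ * d₁ + c₄ * d₂ → (c₁ * c₄ - c₂ * c₃ ≠ 0 ∨ c₁ * d₃ - d₁ * c₃ ≠ 0 ∨ c₁ * d₄ - d₂ * c₃ ≠ 0 ∨ c₂ * d₃ - d₁ * c₄ ≠ 0 ∨ c₂ * d₄ - d₂ * c₄ ≠ 0 ∨ d₁ * d₄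 - d₂ * d₃ ≠ 0) → 1 ≤ ‖((c₁ : ℂ) * ((x 0 : ℂ) + (x 3 : ℂ) * Complex.I) + (c₂ : ℂ) * ((x 1 : ℂ) + (x 4 : ℂ) * Complex.I) + (d₁ : ℂ)) * ((c₃ : ℂ) * ((x 1 : ℂ) + (x 4 : ℂ) * Complex.I) + (c₄ : ℂ) * ((x 2 : ℂ) + (x 5 : ℂ) * Complex.I) + (d₄ : ℂ)) - ((c₁ : ℂ) * ((x 1 : ℂ) + (x 4 : ℂ) * Complex.I) + (c₂ : ℂ) * ((x 2 : ℂ) + (x 5 : ℂ) * Complex.I) + (d₂ : ℂ)) * ((c₃ : ℂ) * ((x 0 : ℂ) + (x 3 : ℂ) * Complex.I) + (c₄ : ℂ) * ((x 1 : ℂ) + (x 4 : ℂ) * Complex.I) + (d₃ : ℂ))‖} → Set.EqOn r.integrand (fun x => 1 / (x 3 * x 5 - x 4 ^ 2) ^ 3) r.domain → r'.domain = {x | x 0 ^ 2 + x 1 ^ 2 ≤ 1 ∧ x 2 ^ 2 + x 3 ^ 2 ≤ 1 ∧ x 4 ^ 2 + x 5 ^ 2 ≤ 1} → Set.EqOn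 r'.integrand (fun _ => 1 / 270) r'.domain → r.value = r'.value) → EqualRankCovolumes

/-- item stmt-KontsevichZagierPeriods-6063 · assembly · rank 1 · closed · moot by None · by planner
sources: KontsevichZagier2001
[assembly] SpFourZCovolume → CoxeterPentachoron → SLTwoZCovolume → EqualRankCovolumes. -/
@[route_item "route-KontsevichZagierPeriods-GaussBonnetChain"]
def Assembly : Prop :=
  SpFourZCovolume → CoxeterPentachoron → SLTwoZCovolume → EqualRankCovolumes

end Summit.KontsevichZagierPeriods.KontsevichZagierPeriods.Theses.GaussBonnetChain
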